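import Literature.AlgebraicGeometry.Motives.MotivatedCycles
import Literature.AlgebraicGeometry.Motives.MotivatedCyclesProofs
import Literature.AlgebraicGeometry.Motives.BettiRealization
import HarnessLib

/-!
# Motivated automorphisms: the `K`-points of André's motivated Galois group, in elementary form

Let `W` be a Weil cohomology theory (`Literature.AlgebraicGeometry.Motives.WeilCohomology k K`)
and `S` a family of `k`-schemes (in the applications: smooth projective complex varieties, stable
under products). Y. André, *Pour une théorie inconditionnelle des motifs*, Publ. Math. IHÉS 83
(1996), §4.6, Définition (p. 24), defines the **motivic Galois group** of the Tannakian category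
`M(𝒱')` of motives modelled on a family `𝒱'` (built from *motivated* correspondences, Thm. 0.4,
p. 8) as the automorphism scheme `G_{𝒱'} = Aut^⊗(H_B | M(𝒱'))` of the Betti realisation — a
pro-algebraic group with a central homomorphism `w : 𝔾_m → G_{𝒱'}` (the grading) — and records
(ibid. (i), (ii)) that `G(M)` is (pro-)reductive and is the algebraic subgroup of `GL(H_B(M))`
fixing the motivated cycles among the mixed tensors on `H_B(M)`, every fixed tensor being
motivated (Chevalley's theorem in the form of Deligne, *Hodge cycles on abelian varieties*
(1982), §3, Prop. 3.1 (c)).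

This file vendors the group **in elementary, `K`-points form**, as a named subgroup, exactly as
it is inlined (three hypotheses on a family `g`) in the route
`Summit.HodgeConjecture.HodgeConjecture.Theses.PeriodsPolice` (items `PeriodsPoliceHodgeClasses`,
`CompactCommutantTrivial`): `WeilCohomology.motivatedAut W S` is the subgroup of
`∏_{Y, i} GL_K(Hⁱ(Y))` (all `k`-schemes `Y`, all degrees `i`) of the families `g = (g_{Y,i})`
which, on the smooth projective members of `S`, are

* natural for every morphism `f : Y ⟶ Y'` between members: `g (f* x) = f* (g x)`
  (`WeilCohomology.IsNaturalOn`);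
* multiplicative for cup products: `g (x ∪ y) = g x ∪ g y` (`WeilCohomology.IsMultiplicativeOn`);
* the identity on every motivated class `x ∈ A_mot^p(Y)` (`W.motivatedClasses`, André 1996 §2.1
  Déf. 1): `g x = x` (`WeilCohomology.FixesMotivatedClassesOn`).

`BettiHodgeData.motivatedAut B S := B.W.motivatedAut S` is the Betti-layer specialisation
(`B : BettiHodgeData k`, `W = B.W : WeilCohomology k ℚ`).

## Main statements (all proved; `g ∈ W.motivatedAut S`, `Y ∈ S` smooth projective of dimension `m`)

* `WeilCohomology.motivatedAut` is a subgroup (products, inverses); `mem_motivatedAut_iff`;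
  `motivatedAut_anti` : restriction along `S ⊆ S'`, `W.motivatedAut S' ≤ W.motivatedAut S`.
* `map_one_of_mem_motivatedAut` : `g 1_Y = 1_Y` (multiplicativity and `dim H⁰(Y) = 1`).
* `apply_eq_self_of_mem_motivatedAut` : under hard Lefschetz (`W.HasHardLefschetz`, André's
  standing hypothesis, needed for "algebraic ⇒ motivated",
  `WeilCohomology.isMotivatedClass_of_mem_ratAlgebraicClasses`), `g` is the identity on
  `H²ᵐ(Y)` (it fixes the motivated class `ηᵐ ≠ 0` of a hyperplane class `η`, which spans);
  hence `trace_apply_of_mem_motivatedAut` (`tr_Y ∘ g = tr_Y`) and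
  `cupPairing_apply_of_mem_motivatedAut` (`g` preserves the Poincaré pairing `tr (x ∪ y)`).
* `apply_eq_of_isInducedBy_of_mem_motivatedAut` : `g` commutes with every linear map
  `T : Hⁱ(Y) → Hʲ(Y')` induced (`PreWeilCohomology.IsInducedBy`, Kleiman's pairing form) by a
  motivated correspondence `u ∈ A_mot^c(Y × Y')`, provided `Y × Y' ∈ S` (projection formula,
  naturality for the two projections, `g u = u`, invariance of the trace and perfectness of the
  Poincaré pairing). This is the formal content of "`g` is an automorphism of the fibre functor
  on motivated correspondences".

## Informal identification with André's group (docstring only, not formalised)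

Let `k ⊆ ℂ`, `W` be Betti cohomology and `S` be stable under products with a member of positive
dimension, and let `G = G_{S} = Aut^⊗(H_B | M(S))` (André 1996 §4.6), with `χ : G → 𝔾_m` the
character through which `G` acts on the rank-one space `H_B(𝟙(-1))` (realised inside `H²(Y)` on
the line of a hyperplane class, a motivated class). Restricting a `ℚ`-point of `G` to the objects
`h(Y)`, `Y ∈ S`, gives a family natural for graphs of morphisms and multiplicative (the Künneth
isomorphism `H(Y) ⊗ H(Y') ≅ H(Y × Y')` is the tensor structure of the fibre functor and `∪` is
`Δ*` after Künneth), which multiplies a motivated class `ξ ∈ A_mot^p(Y) = Hom(𝟙(-p), h(Y))` by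
`χ(g)⁻ᵖ`. Conversely, for `S` stable under products a family as above extends to the motives
`(Y, q, n)` cut out by motivated idempotents (it commutes with them,
`apply_eq_of_isInducedBy_of_mem_motivatedAut`) and is compatible with `⊗` (multiplicativity and
naturality for the projections). Hence **restriction to `S` identifies `W.motivatedAut S`, modulo
its normal subgroup of families that are the identity on the smooth projective members of `S`
(the definition leaves `g_{Y,i}` unconstrained elsewhere), with the `ℚ`-points of
`G¹ := ker χ ⊆ G`** — the analogue of the Hodge (special Mumford–Tate) group inside the
Mumford–Tate group: the central weight cocharacter `w(c)`, `c ∈ ℚˣ`, `c ≠ ±1`, is a `ℚ`-point of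
`G` acting on `H²ᵖ` by `c^{±2p}`, so it does **not** fix motivated classes of positive
codimension pointwise; `G = w(𝔾_m) · G¹`. Statements of the form "every `g ∈ W.motivatedAut S`
preserves the subspace of Hodge classes" are insensitive to this difference. The algebraic-group
structure (the same three conditions over every commutative `ℚ`-algebra define an affine group
scheme whose `ℚ`-points are the restrictions of `W.motivatedAut S` to `S`), reductivity
(André 1996 §4.6 (i)) and "motivated classes = invariants" (ibid. (ii)) are **not** formalised
here.

## Design choices

* Generality: any Weil cohomology theory `W : WeilCohomology k K` (`W.motivatedClasses` needs the
  axioms and `CharZero K`), any `S : Set (SchemeOver k)`; conditions are imposed only on smooth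
  projective members of `S`, with the dimension witness `IsSmoothProjective m Y` quantified as in
  the rest of the trunk, verbatim as in the route items (so that they can be restated over this
  name).
* The ambient group is Mathlib's `Pi.group` over `LinearEquiv.automorphismGroup`
  (`(f * g) x = f (g x)`, `LinearEquiv.mul_apply`; `⇑1 = id`; `⇑f⁻¹ = ⇑f.symm`).
* No product-closure hypothesis is built in: the lemma on correspondences asks `Y ⊗ Y' ∈ S`
  explicitly; `motivatedAut_anti` gives the restriction maps along `S ⊆ S'`.
* Mathlib has no motives / motivic Galois groups (searched `motivic`, `Tannaka`, `MumfordTate`: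
  only `Literature` material); the tree's `HodgeStructure.mumfordTateGroup` is the Hodge-theoretic
  analogue.

## References

* Y. André, *Pour une théorie inconditionnelle des motifs*, Publ. Math. IHÉS 83 (1996), 5–49:
  Thm. 0.4 (p. 8); §2.1 Déf. 1 (p. 14); §4.2–4.4 (pp. 22–23); §4.6 Définition, (i)–(iii) and
  Remarques (pp. 24–25). [Andre1996Motifs]
* P. Deligne, *Hodge cycles on abelian varieties*, in LNM 900 (1982), §3, Prop. 3.1.
  [Deligne1982HodgeCycles]
* S. Kleiman, *Algebraic cycles and the Weil conjectures* (1968), §1.2–1.3 (Poincaré duality,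
  correspondences in pairing form). [Kleiman1968]
-/

universe u v

open CategoryTheory AlgebraicGeometry MonoidalCategory CartesianMonoidalCategory
open scoped TensorProduct

noncomputable section

namespace Literature.AlgebraicGeometry.Motives

namespace WeilCohomology

variable {k : Type u} [Field k] {K : Type v} [Field K] [CharZero K] (W : WeilCohomology k K)

/-! ## The three conditions -/

section Conditions

-- The binders `(S) (g)` are written on each definition (not as section variables) so that these
-- three predicates are visibly *open* definitions, not closed named facts.

/-- The family `g = (g_{Y,i} ∈ GL(Hⁱ(Y)))` *is natural on `S`*: for smooth projective members
`Y`, `Y'` of `S` and every `k`-morphism `f : Y ⟶ Y'`, `g_Y ∘ f* = f* ∘ g_{Y'}` on each `Hⁱ`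
(automorphisms of the fibre functor commute with the morphisms of motives given by graphs;
André 1996 §4.2, §4.6). [cite: Andre1996Motifs, §4.6 Définition (p. 24)] -/
def IsNaturalOn (S : Set (SchemeOver k))
    (g : ∀ (Y : SchemeOver k) (i : ℕ), W.obj Y i ≃ₗ[K] W.obj Y i) : Prop :=
  ∀ ⦃m : ℕ⦄ ⦃Y : SchemeOver k⦄, Y ∈ S → IsSmoothProjective m Y →
    ∀ ⦃m' : ℕ⦄ ⦃Y' : SchemeOver k⦄, Y' ∈ S → IsSmoothProjective m' Y' →
      ∀ (f : Y ⟶ Y') (i : ℕ) (x : W.obj Y' i),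
        g Y i (W.pullback f i x) = W.pullback f i (g Y' i x)

/-- The family `g` *is multiplicative on `S`*: for every smooth projective member `Y` of `S`,
`g_Y (x ∪ y) = g_Y x ∪ g_Y y` (compatibility of a tensor automorphism of the fibre functor with
the Künneth isomorphism and `Δ*`; André 1996 §4.3–4.4, §4.6). [cite: Andre1996Motifs, §4.6 Définition (p. 24)] -/
def IsMultiplicativeOn (S : Set (SchemeOver k))
    (g : ∀ (Y : SchemeOver k) (i : ℕ), W.obj Y i ≃ₗ[K] W.obj Y i) : Prop :=
  ∀ ⦃m : ℕ⦄ ⦃Y : SchemeOver k⦄, Y ∈ S → IsSmoothProjective m Y →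
    ∀ ⦃i j l : ℕ⦄ (h : i + j = l) (x : W.obj Y i) (y : W.obj Y j),
      g Y l (W.cup h x y) = W.cup h (g Y i x) (g Y j y)

/-- The family `g` *fixes the motivated classes on `S`*: for every smooth projective member `Y`
of `S` (of dimension `m`) and every `p`, `g_Y` is the identity on the space
`A_mot^p(Y) = W.motivatedClasses m Y p ⊆ H²ᵖ(Y)` of motivated classes (André 1996 §2.1 Déf. 1;
§4.6 (ii): the motivated Galois group is cut out inside `GL(H_B)` by the motivated cycles). [cite: Andre1996Motifs, §4.6 (ii) (p. 24) with §2.1 Déf. 1 (p. 14)] -/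
def FixesMotivatedClassesOn (S : Set (SchemeOver k))
    (g : ∀ (Y : SchemeOver k) (i : ℕ), W.obj Y i ≃ₗ[K] W.obj Y i) : Prop :=
  ∀ ⦃m : ℕ⦄ ⦃Y : SchemeOver k⦄, Y ∈ S → IsSmoothProjective m Y →
    ∀ (p : ℕ), ∀ x ∈ W.motivatedClasses m Y p, g Y (2 * p) x = x

end Conditions

/-! ## The subgroup -/

/-- **The group of motivated automorphisms of `W` over the family `S`** (the `K`-points of
André's motivated Galois group `G_S = Aut^⊗(H | M(S))` in elementary form, André 1996 §4.6,
Définition p. 24 and (ii); see the module docstring for the precise identification — restricted to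
`S` it is the kernel `G¹` of the Tate character, the components off `S` being unconstrained):
the subgroup of `∏_{Y,i} GL_K(Hⁱ(Y))` of the families `g` that are natural for morphisms between
smooth projective members of `S` (`W.IsNaturalOn S g`), multiplicative for cup products
(`W.IsMultiplicativeOn S g`) and the identity on motivated classes
(`W.FixesMotivatedClassesOn S g`). [cite: Andre1996Motifs, §4.6 Définition and (ii) (p. 24)] -/
def motivatedAut (S : Set (SchemeOver k)) :
    Subgroup (∀ (Y : SchemeOver k) (i : ℕ), W.obj Y i ≃ₗ[K] W.obj Y i) where
  carrier := {g | W.IsNaturalOn S g ∧ W.IsMultiplicativeOn S g ∧ W.FixesMotivatedClassesOn S g}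
  mul_mem' := by
    rintro g h ⟨hgn, hgc, hgf⟩ ⟨hhn, hhc, hhf⟩
    refine ⟨?_, ?_, ?_⟩
    · intro m Y hYS hY m' Y' hY'S hY' f i x
      simp only [Pi.mul_apply, LinearEquiv.mul_apply]
      rw [hhn hYS hY hY'S hY' f i x, hgn hYS hY hY'S hY' f i]
    · intro m Y hYS hY i j l hij x y
      simp only [Pi.mul_apply, LinearEquiv.mul_apply]
      rw [hhc hYS hY hij, hgc hYS hY hij]
    · intro m Y hYS hY p x hx
      simp only [Pi.mul_apply, LinearEquiv.mul_apply]
      rw [hhf hYS hY p x hx, hgf hYS hY p x hx]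
  one_mem' := by
    refine ⟨?_, ?_, ?_⟩
    · intro m Y hYS hY m' Y' hY'S hY' f i x
      simp only [Pi.one_apply, LinearEquiv.coe_one, id_eq]
    · intro m Y hYS hY i j l hij x y
      simp only [Pi.one_apply, LinearEquiv.coe_one, id_eq]
    · intro m Y hYS hY p x hx
      simp only [Pi.one_apply, LinearEquiv.coe_one, id_eq]
  inv_mem' := by
    rintro g ⟨hgn, hgc, hgf⟩
    refine ⟨?_, ?_, ?_⟩
    · intro m Y hYS hY m' Y' hY'S hY' f i x
      simp only [Pi.inv_apply, LinearEquiv.coe_inv]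
      rw [LinearEquiv.symm_apply_eq, hgn hYS hY hY'S hY' f i, LinearEquiv.apply_symm_apply]
    · intro m Y hYS hY i j l hij x y
      simp only [Pi.inv_apply, LinearEquiv.coe_inv]
      rw [LinearEquiv.symm_apply_eq, hgc hYS hY hij, LinearEquiv.apply_symm_apply,
        LinearEquiv.apply_symm_apply]
    · intro m Y hYS hY p x hx
      simp only [Pi.inv_apply, LinearEquiv.coe_inv]
      rw [LinearEquiv.symm_apply_eq]
      exact (hgf hYS hY p x hx).symm

variable {W}
variable {S S' : Set (SchemeOver k)} {g : ∀ (Y : SchemeOver k) (i : ℕ), W.obj Y i ≃ₗ[K] W.obj Y i}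

/-- Membership in `W.motivatedAut S`, unfolded: naturality, multiplicativity and fixing the
motivated classes, on `S`. [folklore] -/
theorem mem_motivatedAut_iff :
    g ∈ W.motivatedAut S ↔
      W.IsNaturalOn S g ∧ W.IsMultiplicativeOn S g ∧ W.FixesMotivatedClassesOn S g :=
  Iff.rfl

/-- An element of `W.motivatedAut S` is natural on `S`. [folklore] -/
theorem isNaturalOn_of_mem_motivatedAut (hg : g ∈ W.motivatedAut S) : W.IsNaturalOn S g :=
  hg.1

/-- An element of `W.motivatedAut S` is multiplicative on `S`. [folklore] -/
theorem isMultiplicativeOn_of_mem_motivatedAut (hg : g ∈ W.motivatedAut S) :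
    W.IsMultiplicativeOn S g :=
  hg.2.1

/-- An element of `W.motivatedAut S` fixes the motivated classes on `S`. [folklore] -/
theorem fixesMotivatedClassesOn_of_mem_motivatedAut (hg : g ∈ W.motivatedAut S) :
    W.FixesMotivatedClassesOn S g :=
  hg.2.2

/-- **Restriction along `S ⊆ S'`**: the conditions for `S'` imply those for `S`, i.e.
`W.motivatedAut S' ≤ W.motivatedAut S` (the restriction map `G_{S'} → G_S` of André 1996 §4.6,
Exemples: the category of motives is the inductive limit of the `M(S)` ordered by inclusion). [cite: Andre1996Motifs, §4.5–4.6 (pp. 24–25)] -/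
theorem motivatedAut_anti (h : S ⊆ S') : W.motivatedAut S' ≤ W.motivatedAut S := by
  rintro g ⟨hn, hc, hf⟩
  exact ⟨fun _ _ hYS hY _ _ hY'S hY' ↦ hn (h hYS) hY (h hY'S) hY',
    fun _ _ hYS hY ↦ hc (h hYS) hY, fun _ _ hYS hY ↦ hf (h hYS) hY⟩

variable (W) in
/-- `S ↦ W.motivatedAut S` is antitone. [folklore] -/
theorem antitone_motivatedAut :
    Antitone (W.motivatedAut : Set (SchemeOver k) → Subgroup _) :=
  fun _ _ h ↦ motivatedAut_anti h

/-! ## Consequences of the axioms of a Weil cohomology theory -/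

section API

variable {m : ℕ} {Y : SchemeOver k}

variable (W) in
/-- `1 ≠ 0` in `H⁰(Y)` for `Y` smooth projective: otherwise `a = 1 ∪ a = 0` for all `a`,
contradicting `dim H⁰(Y) = 1` (`finrank_obj_zero`). (Auxiliary; the same statement is
`WeilCohomology.unit_ne_zero` in `Motives/AbelianVarietyHopf.lean`, not imported here.) [folklore] -/
private theorem one_ne_zero_aux (hY : IsSmoothProjective m Y) : (W.one Y : W.obj Y 0) ≠ 0 := by
  intro h1
  have hall : ∀ a : W.obj Y 0, a = 0 := fun a ↦ by
    rw [← W.one_cup hY (zero_add 0) a, h1, LinearMap.map_zero₂]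
  haveI : Subsingleton (W.obj Y 0) := ⟨fun a b ↦ by rw [hall a, hall b]⟩
  have hfr := W.finrank_obj_zero hY
  rw [Module.finrank_zero_of_subsingleton] at hfr
  exact zero_ne_one hfr

/-- **Motivated automorphisms are unital**: `g_Y (1_Y) = 1_Y` for `Y ∈ S` smooth projective.
Indeed `H⁰(Y) = K · 1` (`finrank_obj_zero`), so `g 1 = c · 1`, and multiplicativity
`g 1 = g (1 ∪ 1) = g 1 ∪ g 1` gives `c = c²` with `c ≠ 0`. [folklore] -/
theorem map_one_of_mem_motivatedAut (hg : g ∈ W.motivatedAut S) (hYS : Y ∈ S)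
    (hY : IsSmoothProjective m Y) : g Y 0 (W.one Y) = W.one Y := by
  have hone := W.one_ne_zero_aux hY
  haveI := W.finite_obj hY 0
  obtain ⟨c, hc⟩ :=
    (finrank_eq_one_iff_of_nonzero' (W.one Y) hone).mp (W.finrank_obj_zero hY) (g Y 0 (W.one Y))
  have hc0 : c ≠ 0 := by
    rintro rfl
    rw [zero_smul, eq_comm, LinearEquiv.map_eq_zero_iff] at hc
    exact hone hc
  have hmul := hg.2.1 hYS hY (zero_add 0) (W.one Y) (W.one Y)
  rw [W.one_cup hY (zero_add 0), ← hc, LinearMap.map_smul₂, map_smul,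
    W.one_cup hY (zero_add 0)] at hmul
  -- `hmul : c • 1 = c • c • 1`
  have h1 : W.one Y = c • W.one Y := smul_right_injective (W.obj Y 0) hc0 hmul
  rw [← hc]
  exact h1.symm

/-- **Motivated automorphisms are the identity in top degree** (under hard Lefschetz): for
`g ∈ W.motivatedAut S` and `Y ∈ S` smooth projective of dimension `m`, `g_Y = id` on `H²ᵐ(Y)`.
For `m ≥ 1`, a hyperplane class `η` has `tr (ηᵐ) = deg Y > 0` (`trace_pow_of_isHyperplaneClass`),
so `ηᵐ ≠ 0` spans the line `H²ᵐ(Y)` (`finrank_obj_two_mul`) and is rational algebraic, hence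
motivated (`isMotivatedClass_of_mem_ratAlgebraicClasses`, which uses `W.HasHardLefschetz` for the
Lefschetz involution of the auxiliary product), hence fixed; for `m = 0` use
`map_one_of_mem_motivatedAut`. (In André's terms: `χ(g) = 1`, cf. the module docstring.) [folklore] -/
theorem apply_eq_self_of_mem_motivatedAut (hL : W.HasHardLefschetz) (hg : g ∈ W.motivatedAut S)
    (hYS : Y ∈ S) (hY : IsSmoothProjective m Y) (x : W.obj Y (2 * m)) : g Y (2 * m) x = x := by
  haveI := W.finite_obj hY (2 * m)
  -- a nonzero class of top degree fixed by `g`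
  obtain ⟨e, he0, hge⟩ : ∃ e : W.obj Y (2 * m), e ≠ 0 ∧ g Y (2 * m) e = e := by
    obtain _ | r := m
    · exact ⟨W.one Y, W.one_ne_zero_aux hY, map_one_of_mem_motivatedAut hg hYS hY⟩
    · obtain ⟨η, hη⟩ := W.isHyperplaneClass_nonempty hY (Nat.le_add_left 1 r)
      obtain ⟨d, hd, hdtr⟩ := W.trace_pow_of_isHyperplaneClass hY η hη
      refine ⟨W.pow Y η (r + 1), fun h0 ↦ ?_, ?_⟩
      · rw [h0, map_zero] at hdtr
        exact hd.ne' (Nat.cast_eq_zero.mp hdtr.symm)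
      · exact hg.2.2 hYS hY (r + 1) _
          (W.isMotivatedClass_of_mem_ratAlgebraicClasses hL hY
            (W.pow_succ_mem_ratAlgebraicClasses hY
              (W.mem_ratAlgebraicClasses_of_isHyperplaneClass hY hη) r)).mem_motivatedClasses
  obtain ⟨c, rfl⟩ := (finrank_eq_one_iff_of_nonzero' e he0).mp (W.finrank_obj_two_mul hY) x
  rw [map_smul, hge]

/-- **Motivated automorphisms preserve the trace** (under hard Lefschetz): `tr_Y (g x) = tr_Y x`
for `Y ∈ S` smooth projective of dimension `m` and `x ∈ H²ᵐ(Y)`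
(`apply_eq_self_of_mem_motivatedAut`). [folklore] -/
theorem trace_apply_of_mem_motivatedAut (hL : W.HasHardLefschetz) (hg : g ∈ W.motivatedAut S)
    (hYS : Y ∈ S) (hY : IsSmoothProjective m Y) (x : W.obj Y (2 * m)) :
    W.trace Y m (g Y (2 * m) x) = W.trace Y m x := by
  rw [apply_eq_self_of_mem_motivatedAut hL hg hYS hY x]

/-- **Motivated automorphisms preserve the Poincaré pairing** (under hard Lefschetz):
`tr_Y (g x ∪ g y) = tr_Y (x ∪ y)` for `Y ∈ S` smooth projective of dimension `m`, `x ∈ Hⁱ(Y)`,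
`y ∈ Hʲ(Y)`, `i + j = 2m` (multiplicativity and invariance of the trace). [folklore] -/
theorem cupPairing_apply_of_mem_motivatedAut (hL : W.HasHardLefschetz)
    (hg : g ∈ W.motivatedAut S) (hYS : Y ∈ S) (hY : IsSmoothProjective m Y) {i j : ℕ}
    (h : i + j = 2 * m) (x : W.obj Y i) (y : W.obj Y j) :
    W.cupPairing Y m i j h (g Y i x) (g Y j y) = W.cupPairing Y m i j h x y := by
  simp only [PreWeilCohomology.cupPairing, LinearMap.compr₂_apply]
  rw [← hg.2.1 hYS hY h x y, trace_apply_of_mem_motivatedAut hL hg hYS hY]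

/-- **Motivated automorphisms commute with motivated correspondences** (under hard Lefschetz).
Let `Y, Y' ∈ S` be smooth projective of dimensions `m, m'` with `Y × Y' ∈ S`, let
`u ∈ A_mot^c(Y × Y')` be a motivated class and let `T : Hⁱ(Y) → Hʲ(Y')` be induced by the
correspondence `u` in Kleiman's pairing form (`W.IsInducedBy m m' u T hj hm`:
`tr_{Y'} (T x ∪ y) = tr_{Y×Y'} ((pr₁* x ∪ u) ∪ pr₂* y)`). Then `g (T x) = T (g x)` for every
`g ∈ W.motivatedAut S`. Proof: by perfectness of the Poincaré pairing on `Y'` it suffices to pair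
with `g y`; `tr (g (T x) ∪ g y) = tr (T x ∪ y)` (`cupPairing_apply_of_mem_motivatedAut`), and by
the projection formula both sides become traces over `Y × Y'`, equal because `g` fixes `u`, is
natural for `pr₁`, `pr₂`, multiplicative, and preserves `tr_{Y×Y'}`. This is the compatibility
of `g` with the morphisms of André's category of motives modelled on `S` (André 1996 §4.2, §4.6
Définition). [cite: Andre1996Motifs, §4.6 Définition (p. 24) with §4.2] -/
theorem apply_eq_of_isInducedBy_of_mem_motivatedAut (hL : W.HasHardLefschetz)
    (hg : g ∈ W.motivatedAut S) {m' : ℕ} {Y' : SchemeOver k} (hYS : Y ∈ S)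
    (hY : IsSmoothProjective m Y) (hY'S : Y' ∈ S) (hY' : IsSmoothProjective m' Y')
    (hYY'S : Y ⊗ Y' ∈ S) {c i j j' : ℕ} {u : W.obj (Y ⊗ Y') (2 * c)}
    (hu : u ∈ W.motivatedClasses (m + m') (Y ⊗ Y') c) {T : W.obj Y i →ₗ[K] W.obj Y' j}
    {hj : j + j' = 2 * m'} {hm : i + 2 * c + j' = 2 * (m + m')}
    (hT : W.IsInducedBy m m' u T hj hm) (x : W.obj Y i) :
    g Y' j (T x) = T (g Y i x) := by
  have hYY' : IsSmoothProjective (m + m') (Y ⊗ Y') := IsSmoothProjective.tensor_holds hY hY'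
  have hn := hg.1
  have hc := hg.2.1
  have hf := hg.2.2
  haveI := W.isPerfPair_cupPairing hY' j j' hj
  refine (LinearMap.IsPerfPair.bijective_left (W.cupPairing Y' m' j j' hj)).1 ?_
  ext y
  obtain ⟨y, rfl⟩ := (g Y' j').surjective y
  rw [cupPairing_apply_of_mem_motivatedAut hL hg hY'S hY' hj (T x) y]
  simp only [PreWeilCohomology.cupPairing, LinearMap.compr₂_apply]
  rw [hT x y, hT (g Y i x) (g Y' j' y)]
  conv_lhs => rw [← apply_eq_self_of_mem_motivatedAut hL hg hYY'S hYY' (W.cup hm _ _)]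
  rw [hc hYY'S hYY' hm, hc hYY'S hYY' rfl, hf hYY'S hYY' c u hu,
    hn hYY'S hYY' hYS hY (fst Y Y') i x, hn hYY'S hYY' hY'S hY' (snd Y Y') j' y]

end API

end WeilCohomology

/-! ## The Betti layer -/

namespace BettiHodgeData

variable {k : Type} [Field k] [Algebra k ℂ] (B : BettiHodgeData k)

/-- **The group of motivated automorphisms of the Betti layer** `B : BettiHodgeData k` over a
family `S` of `k`-schemes: `B.W.motivatedAut S`, the `ℚ`-points form of André's motivated Galois
group `G_S` (André 1996 §4.6; see `WeilCohomology.motivatedAut` and the module docstring for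
the precise identification with the kernel `G¹` of the Tate character). For `k = ℂ`,
`B = P.B` and `S` product-closed this is the group quantified over in the route items
`PeriodsPolice.PeriodsPoliceHodgeClasses` / `CompactCommutantTrivial`. [cite: Andre1996Motifs, §4.6 Définition and (ii) (p. 24)] -/
abbrev motivatedAut (S : Set (SchemeOver k)) :
    Subgroup (∀ (Y : SchemeOver k) (i : ℕ), B.W.obj Y i ≃ₗ[ℚ] B.W.obj Y i) :=
  B.W.motivatedAut S

/-- Membership in `B.motivatedAut S`, unfolded. [folklore] -/
theorem mem_motivatedAut_iff {S : Set (SchemeOver k)}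
    {g : ∀ (Y : SchemeOver k) (i : ℕ), B.W.obj Y i ≃ₗ[ℚ] B.W.obj Y i} :
    g ∈ B.motivatedAut S ↔
      B.W.IsNaturalOn S g ∧ B.W.IsMultiplicativeOn S g ∧ B.W.FixesMotivatedClassesOn S g :=
  Iff.rfl

end BettiHodgeData

end Literature.AlgebraicGeometry.Motives

end
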